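import Mathlib
import Literature.Combinatorics.Optimization.ReflectionRelations
import HarnessLib

/-!
# The `I₂(m)`-permutahedron of a polygon: Kaibel–Pashkovich's Proposition 4 and Theorem 3 for a
# general polytope `P ⊆ ℝ²` — PROVED

Source: V. Kaibel, K. Pashkovich, *Constructing extended formulations from reflection relations*,
IPCO 2011 [KaibelPashkovich2011] (held text `paper:arxiv-1011.3597`, §4.1 and §4.1.1, arXiv p. 9).
Verbatim: "If one distinguishes arbitrarily the topological closure of one of them as the fundamental
domain `Φ_G` of `G`, then, for every point `x ∈ ℝⁿ`, there is a unique point `x_Φ ∈ Φ_G` that belongs to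
the orbit of `x` under the action of the group `G` on `ℝⁿ`. … the `G`-permutahedron `Π_G(P)` of `P` is
the convex hull of the union of the orbit of `P` under the action of `G`. … The group `I₂(m)` is
generated by the reflections at `H_0` and `H_{π/m}`. … The group `I₂(m)` consists of the (finite) set of
all reflections `ϱ_{H_{kπ/m}}` (for `k ∈ ℤ`) and the (finite) set of all rotations around the origin by
angles `2kπ/m` (for `k ∈ ℤ`). We choose `Φ_{I₂(m)} = {x ∈ ℝ² : x₂ ≥ 0, x ∈ H^≤_{π/m}}` as the fundamental
domain. **Proposition 4.** Let `𝓡` be induced by the sequence `(R_{H^≤_{π/m}}, R_{H^≤_{2π/m}},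
R_{H^≤_{4π/m}}, …, R_{H^≤_{2^rπ/m}})` of reflection relations with `r = ⌈log(m)⌉`. If `P ⊆ ℝ²` is a
polytope with `v_Φ ∈ P` for each vertex `v` of `P`, then we have `𝓡(P) = Π_{I₂(m)}(P)`. *Proof.* With
`Q = Π_{I₂(m)}(P)`, the first condition of Theorem 1 is satisfied. Furthermore, we have `Q = conv(W)`
with `W = {γ.v : γ ∈ I₂(m), v vertex of P}`. Let `w ∈ W` be some point with `w = γ.v` for some vertex
`v` of `P` and `γ ∈ I₂(m)`. Observing that `ϱ*_{H^≤_{π/m}} ∘ ϱ*_{H^≤_{2π/m}} ∘ ⋯ ∘ ϱ*_{H^≤_{2^rπ/m}}(w)`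
is contained in `Φ_{I₂(m)}`, we conclude that it equals `w_Φ = v_Φ ∈ P`. … **Theorem 3.** For each
polytope `P ⊆ ℝ²` with `v_Φ ∈ P` for each vertex `v` of `P` that admits an extended formulation with
`n'` variables and `f'` inequalities, there is an extended formulation of `Π_{I₂(m)}(P)` with
`n' + ⌈log(m)⌉ + 1` variables and `f' + 2⌈log(m)⌉ + 2` inequalities."

`ReflectionRelations.lean` proves Proposition 4 / Theorem 3 only for `P` = one vertex of the regular
`N`-gon (`RegularPolygon.hasEFOfSize_convexHull_vertex`). This file proves them for an arbitrary
`P = conv V`, in the same normalisation (the tree's `N`-gon has its vertices at the odd multiples of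
`π/N`, so Kaibel–Pashkovich's picture is rotated by `π/N`: the mirrors are `RegularPolygon.mirrors N
(⌈log₂ N⌉ + 1)` at the angles `(2^s + 1)π/N`, the fundamental wedge is the sector of directions
`[π/N, 2π/N]`).

## What is proved (no named fact)

* plane geometry of lines through the origin: `side φ x = ⟨(−sin φ, cos φ), x⟩`, `side_reflectAt`
  (`side_ψ(ϱ_{H_φ} x) = −side_{2φ−ψ}(x)`), the three-line identity `side_three`, the reflection matrix
  `reflectAt_lineNormal_apply`, rotations `rot`, `reflect_reflect` (two reflections = rotation by twice
  the angle), `reflect_rot`, `rot_reflect`, `rot_rot`;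
* the group `I₂(N)` as printed: `axisRefl N k = ϱ_{H_{kπ/N}}`, `turn N k = rot_{2kπ/N}`, the
  composition laws (`axisRefl_axisRefl`, `axisRefl_turn`, `turn_axisRefl`, `turn_turn`), the orbit
  `orbitSet N V`, the orbit relation `InOrbit` (an equivalence: `.rfl`, `.symm`, `.trans`), and the
  **`I₂(N)`-permutahedron** `dihedralHull N P = conv(orbitSet N P)` (`dihedralHull_convexHull`,
  `axisRefl_mem_dihedralHull` = condition 1 of Theorem 1);
* the fundamental wedge `wedge N = {side_{π/N} ≥ 0, side_{2π/N} ≤ 0}` and **"`ϱ* ∘ ⋯ ∘ ϱ*(w)` is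
  contained in `Φ`"**: `canonSeq_mirrors_mem_wedge` (the top two mirrors `step_top` — the only place the
  three-line identity is needed — then `step_generic` down to the wedge);
* **uniqueness of orbit representatives in the wedge** (`eq_of_inOrbit_of_mem_wedge`, via polar
  coordinates `exists_polar` and the angle normalisation `exists_angle_mem_Icc`), the orbit invariance
  `inOrbit_canonSeq_mirrors` / `canonSeq_mirrors_eq_of_inOrbit` ("it equals `w_Φ = v_Φ`");
* **Proposition 4** `KaibelPashkovich2011_prop4 : seqImage (mirrors N (⌈log₂ N⌉+1)) P = dihedralHull N P`
  for `N ≥ 2`, `P = conv V`, `ϱ* ∘ ⋯ ∘ ϱ*(v) ∈ P` for all `v ∈ V` (and the orbit form `_orbit`), and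
  **Theorem 3** `KaibelPashkovich2011_thm3 : HasEFOfSize P r → HasEFOfSize (dihedralHull N P)
  (r + 2⌈log₂ N⌉ + 2)`.

Deviations from print: the representative `v_Φ` is taken to be the canonical image `ϱ* ∘ ⋯ ∘ ϱ*(v)`
itself, which is justified by `canonSeq_mirrors_mem_wedge` + `eq_of_inOrbit_of_mem_wedge` (it is THE
point of `Φ` in the orbit of `v`); a generating set `V` replaces "the vertices of `P`"; `N ≥ 2`; only the
number of inequalities is tracked. Honest framing: Literature infrastructure on extended formulations;
nothing here bears on `P ≠ NP`.
-/

noncomputable section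

namespace Literature.Combinatorics.Optimization

namespace RegularPolygon

open Real Matrix Finset Literature.Barriers.PneNP

variable {N : ℕ}

/-! ### Lines through the origin: sides, reflections, rotations -/

/-- The signed distance-type functional `⟨(−sin φ, cos φ), x⟩` of the line `H_φ` (`H^≤_φ = {side ≤ 0}`).
[cite: KaibelPashkovich2011, §4.1.1 (arXiv p. 9)] -/
def side (φ : ℝ) (x : Fin 2 → ℝ) : ℝ := lineNormal φ ⬝ᵥ x

/-- `side φ x = −x₁ sin φ + x₂ cos φ`. [cite: KaibelPashkovich2011, §4.1.1 (arXiv p. 9)] -/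
theorem side_eq (φ : ℝ) (x : Fin 2 → ℝ) : side φ x = -Real.sin φ * x 0 + Real.cos φ * x 1 := by
  simp [side, lineNormal, dotProduct, Fin.sum_univ_two]

/-- `⟨n_ψ, n_φ⟩ = cos(ψ − φ)`. [cite: KaibelPashkovich2011, §4.1.1 (arXiv p. 9)] -/
theorem lineNormal_dotProduct_lineNormal (ψ φ : ℝ) :
    lineNormal ψ ⬝ᵥ lineNormal φ = Real.cos (ψ - φ) := by
  simp [lineNormal, dotProduct, Fin.sum_univ_two, Real.cos_sub]
  ring

/-- `ϱ_{H_φ}(x) = x − 2 side_φ(x) n_φ` (unit normal). [cite: KaibelPashkovich2011, §3 (arXiv p. 7)] -/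
theorem reflectAt_lineNormal_eq (φ : ℝ) (x : Fin 2 → ℝ) :
    reflectAt (lineNormal φ) 0 x = x - (2 * side φ x) • lineNormal φ := by
  rw [reflectAt, lineNormal_dotProduct_self, side]
  ext i
  simp only [Pi.add_apply, Pi.smul_apply, smul_eq_mul, Pi.sub_apply]
  ring

/-- **Reflections flip sides**: `side_ψ(ϱ_{H_φ} x) = −side_{2φ−ψ}(x)` (angle `θ ↦ 2φ − θ`).
[cite: KaibelPashkovich2011, §4.1.1 (arXiv p. 9)] -/
theorem side_reflectAt (φ ψ : ℝ) (x : Fin 2 → ℝ) :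
    side ψ (reflectAt (lineNormal φ) 0 x) = -side (2 * φ - ψ) x := by
  obtain ⟨u, rfl⟩ : ∃ u, ψ = φ - u := ⟨φ - ψ, by ring⟩
  have e : 2 * φ - (φ - u) = φ + u := by ring
  rw [reflectAt_lineNormal_eq, side, dotProduct_sub, dotProduct_smul, lineNormal_dotProduct_lineNormal,
    smul_eq_mul, e, ← side, side_eq, side_eq, side_eq]
  simp only [Real.sin_add, Real.sin_sub, Real.cos_add, Real.cos_sub, show φ - u - φ = -u by ring,
    Real.cos_neg]
  have h := Real.sin_sq_add_cos_sq φ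
  have h' := Real.sin_sq_add_cos_sq u
  nlinarith [h, h']

/-- **Three concurrent lines**: `sin(γ−α) side_β = sin(γ−β) side_α + sin(β−α) side_γ`.
[cite: KaibelPashkovich2011, §4.1.1 (arXiv p. 9)] -/
theorem side_three (α β γ : ℝ) (x : Fin 2 → ℝ) :
    Real.sin (γ - α) * side β x = Real.sin (γ - β) * side α x + Real.sin (β - α) * side γ x := by
  simp only [side_eq, Real.sin_sub]
  ring

/-- The canonical map of `H^≤_φ` keeps `x` when `side_φ x ≤ 0` … [cite: KaibelPashkovich2011, §3 (arXiv p. 7)] -/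
theorem canon_lineNormal_of_le {φ : ℝ} {x : Fin 2 → ℝ} (h : side φ x ≤ 0) : canon (lineNormal φ) 0 x = x := by
  rw [canon, if_pos (show lineNormal φ ⬝ᵥ x ≤ 0 from h)]

/-- … and reflects it otherwise. [cite: KaibelPashkovich2011, §3 (arXiv p. 7)] -/
theorem canon_lineNormal_of_gt {φ : ℝ} {x : Fin 2 → ℝ} (h : 0 < side φ x) :
    canon (lineNormal φ) 0 x = reflectAt (lineNormal φ) 0 x := by
  rw [canon, if_neg (show ¬ lineNormal φ ⬝ᵥ x ≤ 0 from not_le.2 h)]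

/-- After the canonical map the point is in `H^≤_φ`. [cite: KaibelPashkovich2011, §3 (arXiv p. 7)] -/
theorem side_canon_le (φ : ℝ) (x : Fin 2 → ℝ) : side φ (canon (lineNormal φ) 0 x) ≤ 0 :=
  dotProduct_canon_le (lineNormal_ne_zero φ) 0 x

/-! ### The canonical map of the mirror sequence lands in the fundamental wedge -/

/-- The fundamental wedge `Φ` of `I₂(N)` in the tree's normalisation: directions between the ray through
`vertex N 0` (angle `π/N`) and the ray at angle `2π/N` (Kaibel–Pashkovich: `{x₂ ≥ 0, x ∈ H^≤_{π/m}}`,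
rotated by `π/N`). [cite: KaibelPashkovich2011, §4.1.1 (arXiv p. 9)] -/
def wedge (N : ℕ) : Set (Fin 2 → ℝ) := {x | 0 ≤ side (π / N) x ∧ side (lineAngle N 0) x ≤ 0}

/-- `2·lineAngle N t − π/N = lineAngle N (t+1)`: reflecting the base ray in the `t`-th mirror gives the
`(t+1)`-st mirror direction. [cite: KaibelPashkovich2011, Prop. 4, proof (arXiv p. 9)] -/
theorem two_mul_lineAngle_sub (N t : ℕ) : 2 * lineAngle N t - π / N = lineAngle N (t + 1) := by
  rw [lineAngle, lineAngle, pow_succ]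
  ring

/-- One generic step (`t + 1 ≤ r − 1`): from the wedge `[π/N, φ_{t+1}]` the `t`-th canonical map leads
into `[π/N, φ_t]`. [cite: KaibelPashkovich2011, Prop. 4, proof (arXiv p. 9)] -/
theorem step_generic (N t : ℕ) {z : Fin 2 → ℝ} (h0 : 0 ≤ side (π / N) z)
    (h1 : side (lineAngle N (t + 1)) z ≤ 0) :
    0 ≤ side (π / N) (canon (lineNormal (lineAngle N t)) 0 z) ∧
      side (lineAngle N t) (canon (lineNormal (lineAngle N t)) 0 z) ≤ 0 := by
  refine ⟨?_, side_canon_le _ _⟩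
  by_cases h : side (lineAngle N t) z ≤ 0
  · rwa [canon_lineNormal_of_le h]
  · rw [canon_lineNormal_of_gt (not_le.1 h), side_reflectAt, two_mul_lineAngle_sub]
    linarith

/-- Descending through the generic steps: from `[π/N, φ_t]` the first `t` mirrors lead into the
fundamental wedge `[π/N, φ_0]`. [cite: KaibelPashkovich2011, Prop. 4, proof (arXiv p. 9)] -/
theorem canonSeq_mirrors_mem_wedge_of : ∀ (t : ℕ) {z : Fin 2 → ℝ}, 0 ≤ side (π / N) z →
    side (lineAngle N t) z ≤ 0 → canonSeq (mirrors N t) z ∈ wedge N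
  | 0, z, h0, h1 => by
      have : mirrors N 0 = [] := by simp [mirrors]
      rw [this, canonSeq]
      exact ⟨h0, h1⟩
  | t + 1, z, h0, h1 => by
      rw [mirrors_succ, canonSeq_append_singleton]
      obtain ⟨h0', h1'⟩ := step_generic N t h0 h1
      exact canonSeq_mirrors_mem_wedge_of t h0' h1'

/-- `2^{⌈log₂ N⌉} < 2N` for `N ≥ 1`. [cite: KaibelPashkovich2011, Prop. 4 (arXiv p. 9: `r = ⌈log m⌉`)] -/
private theorem two_pow_clog_lt (hN : 1 ≤ N) : 2 ^ Nat.clog 2 N < 2 * N := by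
  rcases Nat.eq_or_lt_of_le hN with h1 | h2
  · subst h1; simp
  · have hpos : 0 < Nat.clog 2 N := Nat.clog_pos one_lt_two h2
    have hlt := Nat.pow_pred_clog_lt_self one_lt_two h2
    have : 2 ^ Nat.clog 2 N = 2 * 2 ^ (Nat.clog 2 N).pred := by
      rw [← pow_succ']
      congr 1
      exact (Nat.succ_pred_eq_of_pos hpos).symm
    omega

/-- **The top two steps**: for `N ≥ 2`, `r = ⌈log₂ N⌉`, after the canonical maps of the mirrors `r` and
`r − 1` every point lies in the wedge `[π/N, φ_{r−1}]` (the mirror `r − 1` makes an angle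
`ψ = 2^{r−1}π/N ∈ [π/2, π)` with the base ray; "Observing that `ϱ* ∘ ⋯ ∘ ϱ*(w)` is contained in `Φ`").
[cite: KaibelPashkovich2011, Prop. 4, proof (arXiv p. 9)] -/
theorem step_top (hN : 2 ≤ N) {s : ℕ} (hs : s + 1 = Nat.clog 2 N) (x : Fin 2 → ℝ) :
    0 ≤ side (π / N) (canon (lineNormal (lineAngle N s)) 0 (canon (lineNormal (lineAngle N (s + 1))) 0 x)) ∧
      side (lineAngle N s) (canon (lineNormal (lineAngle N s)) 0
        (canon (lineNormal (lineAngle N (s + 1))) 0 x)) ≤ 0 := by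
  set y := canon (lineNormal (lineAngle N (s + 1))) 0 x with hy
  have hyr : side (lineAngle N (s + 1)) y ≤ 0 := side_canon_le _ _
  refine ⟨?_, side_canon_le _ _⟩
  by_cases h : side (lineAngle N s) y ≤ 0
  · -- keep: the three-line identity with `α = π/N`, `β = φ_s`, `γ = φ_{s+1}`
    rw [canon_lineNormal_of_le h]
    have hid := side_three (π / N) (lineAngle N s) (lineAngle N (s + 1)) y
    have hNr : (0 : ℝ) < N := by exact_mod_cast (show 0 < N by omega)
    -- the angles: `γ − β = β − α = ψ := 2^s π / N`, `γ − α = 2ψ`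
    have e1 : lineAngle N (s + 1) - lineAngle N s = 2 ^ s * π / N := by
      rw [lineAngle, lineAngle, pow_succ]; ring
    have e2 : lineAngle N s - π / N = 2 ^ s * π / N := by rw [lineAngle]; ring
    have e3 : lineAngle N (s + 1) - π / N = 2 * (2 ^ s * π / N) := by
      rw [lineAngle, pow_succ]; ring
    rw [e1, e2, e3] at hid
    -- `0 < ψ < π` and `π ≤ 2ψ < 2π`
    have h2s : 2 * 2 ^ s = 2 ^ Nat.clog 2 N := by rw [← hs, pow_succ]; ring
    have hlt : 2 ^ s < N := by
      have := Nat.pow_pred_clog_lt_self one_lt_two (show 1 < N by omega)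
      rwa [← hs, Nat.pred_succ] at this
    have hge : N ≤ 2 * 2 ^ s := by rw [h2s]; exact Nat.le_pow_clog one_lt_two N
    have hlt2 : 2 * 2 ^ s < 2 * N := by rw [h2s]; exact two_pow_clog_lt (by omega)
    have hψpos : 0 < 2 ^ s * π / N := by positivity
    have hψlt : 2 ^ s * π / N < π := by
      rw [div_lt_iff₀ hNr]
      have : (2 ^ s : ℝ) < N := by exact_mod_cast hlt
      nlinarith [Real.pi_pos]
    have h2ψge : π ≤ 2 * (2 ^ s * π / N) := by
      rw [show 2 * (2 ^ s * π / N) = (2 * 2 ^ s) * π / N by ring, le_div_iff₀ hNr]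
      have : (N : ℝ) ≤ 2 * 2 ^ s := by exact_mod_cast hge
      nlinarith [Real.pi_pos]
    have h2ψlt : 2 * (2 ^ s * π / N) < 2 * π := by
      rw [show 2 * (2 ^ s * π / N) = (2 * 2 ^ s) * π / N by ring, div_lt_iff₀ hNr]
      have : (2 * 2 ^ s : ℝ) < 2 * N := by exact_mod_cast hlt2
      nlinarith [Real.pi_pos]
    have hsinψ : 0 < Real.sin (2 ^ s * π / N) := Real.sin_pos_of_pos_of_lt_pi hψpos hψlt
    have hsin2ψ : Real.sin (2 * (2 ^ s * π / N)) ≤ 0 := by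
      have h' := Real.sin_nonneg_of_nonneg_of_le_pi (x := 2 * (2 ^ s * π / N) - π) (by linarith)
        (by linarith)
      rw [Real.sin_sub_pi] at h'
      linarith
    -- `sin(2ψ) side_β ≥ 0`, so `sin ψ (side_α + side_γ) ≥ 0`, so `side_α ≥ −side_γ ≥ 0`
    have hL : 0 ≤ Real.sin (2 * (2 ^ s * π / N)) * side (lineAngle N s) y :=
      mul_nonneg_of_nonpos_of_nonpos hsin2ψ h
    rw [hid, ← mul_add] at hL
    have hsum : 0 ≤ side (π / N) y + side (lineAngle N (s + 1)) y :=
      nonneg_of_mul_nonneg_right hL hsinψ |> fun h' => by nlinarith [hL, hsinψ, h']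
    linarith
  · -- reflect: `side_α(ϱ_β y) = −side_{2β−α}(y) = −side_γ(y) ≥ 0`
    rw [canon_lineNormal_of_gt (not_le.1 h), side_reflectAt, two_mul_lineAngle_sub]
    linarith

/-- **The composite canonical map of the `⌈log₂ N⌉ + 1` mirrors lands in the fundamental wedge**
("Observing that `ϱ*_{H^≤_{π/m}} ∘ ϱ*_{H^≤_{2π/m}} ∘ ⋯ ∘ ϱ*_{H^≤_{2^rπ/m}}(w)` is contained in
`Φ_{I₂(m)}`"). [cite: KaibelPashkovich2011, Prop. 4, proof (arXiv p. 9)] -/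
theorem canonSeq_mirrors_mem_wedge (hN : 2 ≤ N) (x : Fin 2 → ℝ) :
    canonSeq (mirrors N (Nat.clog 2 N + 1)) x ∈ wedge N := by
  obtain ⟨s, hs⟩ : ∃ s, s + 1 = Nat.clog 2 N :=
    ⟨Nat.clog 2 N - 1, Nat.sub_add_cancel (Nat.clog_pos one_lt_two (by omega))⟩
  rw [← hs, mirrors_succ, canonSeq_append_singleton, mirrors_succ, canonSeq_append_singleton]
  obtain ⟨h0, h1⟩ := step_top hN hs x
  exact canonSeq_mirrors_mem_wedge_of s h0 h1

/-! ### The dihedral group `I₂(N)`: reflections at the lines `kπ/N`, rotations by `2kπ/N` -/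

/-- The rotation of the plane by the angle `θ`. [cite: KaibelPashkovich2011, §4.1.1 (arXiv p. 9: "rotations around the origin by angles `2kπ/m`")] -/
def rot (θ : ℝ) (x : Fin 2 → ℝ) : Fin 2 → ℝ :=
  ![Real.cos θ * x 0 - Real.sin θ * x 1, Real.sin θ * x 0 + Real.cos θ * x 1]

/-- The rotation as a linear map. [cite: KaibelPashkovich2011, §4.1.1 (arXiv p. 9)] -/
def rotLin (θ : ℝ) : (Fin 2 → ℝ) →ₗ[ℝ] (Fin 2 → ℝ) where
  toFun := rot θ
  map_add' x y := by
    ext i; fin_cases i <;> simp [rot] <;> ring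
  map_smul' c x := by
    ext i; fin_cases i <;> simp [rot] <;> ring

/-- `rotLin θ x = rot θ x`. [cite: KaibelPashkovich2011, §4.1.1 (arXiv p. 9)] -/
@[simp] theorem rotLin_apply (θ : ℝ) (x : Fin 2 → ℝ) : rotLin θ x = rot θ x := rfl

/-- The reflection at `H_φ` in coordinates: the matrix `[[cos 2φ, sin 2φ], [sin 2φ, −cos 2φ]]`.
[cite: KaibelPashkovich2011, §4.1.1 (arXiv p. 9)] -/
theorem reflectAt_lineNormal_apply (φ : ℝ) (x : Fin 2 → ℝ) :
    reflectAt (lineNormal φ) 0 x =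
      ![Real.cos (2 * φ) * x 0 + Real.sin (2 * φ) * x 1, Real.sin (2 * φ) * x 0 - Real.cos (2 * φ) * x 1] := by
  rw [reflectAt_lineNormal_eq, side_eq]
  have h := Real.sin_sq_add_cos_sq φ
  ext i
  fin_cases i
  · simp [lineNormal, Real.cos_two_mul, Real.sin_two_mul]
    linear_combination (-2 * x 0) * h
  · simp [lineNormal, Real.cos_two_mul, Real.sin_two_mul]
    linear_combination (0 : ℝ) * h

/-- **Two reflections make a rotation**: `ϱ_{H_γ} ∘ ϱ_{H_α}` is the rotation by `2(γ − α)`.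
[cite: KaibelPashkovich2011, §4.1.1 (arXiv p. 9)] -/
theorem reflect_reflect (γ α : ℝ) (x : Fin 2 → ℝ) :
    reflectAt (lineNormal γ) 0 (reflectAt (lineNormal α) 0 x) = rot (2 * (γ - α)) x := by
  rw [reflectAt_lineNormal_apply, reflectAt_lineNormal_apply, mul_sub, rot]
  ext i
  fin_cases i
  · simp [Real.cos_sub, Real.sin_sub]
    ring
  · simp [Real.cos_sub, Real.sin_sub]
    ring

/-- **A reflection after a rotation is a reflection**: `ϱ_{H_γ} ∘ rot_θ = ϱ_{H_{γ − θ/2}}`.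
[cite: KaibelPashkovich2011, §4.1.1 (arXiv p. 9)] -/
theorem reflect_rot (γ θ : ℝ) (x : Fin 2 → ℝ) :
    reflectAt (lineNormal γ) 0 (rot θ x) = reflectAt (lineNormal (γ - θ / 2)) 0 x := by
  rw [reflectAt_lineNormal_apply, reflectAt_lineNormal_apply, rot,
    show 2 * (γ - θ / 2) = 2 * γ - θ by ring]
  ext i
  fin_cases i
  · simp [Real.cos_sub, Real.sin_sub]
    ring
  · simp [Real.cos_sub, Real.sin_sub]
    ring

/-- The reflection `ϱ_{H_{kπ/N}}` of `I₂(N)` ("the (finite) set of all reflections `ϱ_{H_{kπ/m}}`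
(for `k ∈ ℤ`)"). [cite: KaibelPashkovich2011, §4.1.1 (arXiv p. 9)] -/
def axisRefl (N : ℕ) (k : ℤ) : (Fin 2 → ℝ) → (Fin 2 → ℝ) := reflectAt (lineNormal (k * π / N)) 0

/-- The rotation by `2kπ/N` of `I₂(N)` ("the (finite) set of all rotations around the origin by angles
`2kπ/m` (for `k ∈ ℤ`)"). [cite: KaibelPashkovich2011, §4.1.1 (arXiv p. 9)] -/
def turn (N : ℕ) (k : ℤ) : (Fin 2 → ℝ) → (Fin 2 → ℝ) := rot (2 * k * π / N)

/-- `ϱ_{H_{cπ/N}} ∘ rot_{2kπ/N} = ϱ_{H_{(c−k)π/N}}`. [cite: KaibelPashkovich2011, §4.1.1 (arXiv p. 9)] -/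
theorem axisRefl_turn (c k : ℤ) (x : Fin 2 → ℝ) : axisRefl N c (turn N k x) = axisRefl N (c - k) x := by
  rw [axisRefl, axisRefl, turn, reflect_rot]
  congr 2
  push_cast
  ring

/-- `ϱ_{H_{cπ/N}} ∘ ϱ_{H_{aπ/N}} = rot_{2(c−a)π/N}`. [cite: KaibelPashkovich2011, §4.1.1 (arXiv p. 9)] -/
theorem axisRefl_axisRefl (c a : ℤ) (x : Fin 2 → ℝ) : axisRefl N c (axisRefl N a x) = turn N (c - a) x := by
  rw [axisRefl, axisRefl, turn, reflect_reflect]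
  congr 1
  push_cast
  ring

/-- `rot_0 = id`. [cite: KaibelPashkovich2011, §4.1.1 (arXiv p. 9)] -/
@[simp] theorem turn_zero (x : Fin 2 → ℝ) : turn N 0 x = x := by
  ext i
  fin_cases i <;> simp [turn, rot]

/-- The mirrors of Proposition 4 are reflections of `I₂(N)`: `H_{(2^s+1)π/N} = H_{kπ/N}`, `k = 2^s + 1`.
[cite: KaibelPashkovich2011, Prop. 4 (arXiv p. 9)] -/
theorem reflectAt_lineAngle (s : ℕ) (x : Fin 2 → ℝ) :
    reflectAt (lineNormal (lineAngle N s)) 0 x = axisRefl N ((2 ^ s + 1 : ℕ) : ℤ) x := by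
  rw [axisRefl, lineAngle]
  congr 3
  push_cast
  ring

/-- The orbit of a set `V` under `I₂(N)`: all reflections `ϱ_{H_{kπ/N}}(V)` and all rotations
`rot_{2kπ/N}(V)`. [cite: KaibelPashkovich2011, §4.1 (arXiv p. 9: "the union of the orbit of `P` under the action of `G`")] -/
def orbitSet (N : ℕ) (V : Set (Fin 2 → ℝ)) : Set (Fin 2 → ℝ) :=
  (⋃ k : ℤ, axisRefl N k '' V) ∪ ⋃ k : ℤ, turn N k '' V

/-- The **`I₂(N)`-permutahedron** `Π_{I₂(N)}(P) = conv ⋃_{γ ∈ I₂(N)} γ.P`.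
[cite: KaibelPashkovich2011, §4.1 (arXiv p. 9)] -/
def dihedralHull (N : ℕ) (P : Set (Fin 2 → ℝ)) : Set (Fin 2 → ℝ) := convexHull ℝ (orbitSet N P)

/-- `V ⊆ orbit(V)` (`rot_0 = id`). [cite: KaibelPashkovich2011, §4.1 (arXiv p. 9)] -/
theorem subset_orbitSet (V : Set (Fin 2 → ℝ)) : V ⊆ orbitSet N V := fun x hx =>
  Or.inr (Set.mem_iUnion.2 ⟨0, x, hx, turn_zero x⟩)

/-- The orbit is closed under the reflections of `I₂(N)`. [cite: KaibelPashkovich2011, Prop. 4, proof (arXiv p. 9: "the first condition of Theorem 1 is satisfied")] -/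
theorem axisRefl_mem_orbitSet (c : ℤ) {V : Set (Fin 2 → ℝ)} {x : Fin 2 → ℝ} (hx : x ∈ orbitSet N V) :
    axisRefl N c x ∈ orbitSet N V := by
  rcases hx with hx | hx
  · obtain ⟨k, ⟨v, hv, rfl⟩⟩ := Set.mem_iUnion.1 hx
    exact Or.inr (Set.mem_iUnion.2 ⟨c - k, v, hv, (axisRefl_axisRefl c k v).symm⟩)
  · obtain ⟨k, ⟨v, hv, rfl⟩⟩ := Set.mem_iUnion.1 hx
    exact Or.inl (Set.mem_iUnion.2 ⟨c - k, v, hv, (axisRefl_turn c k v).symm⟩)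

/-- `orbit` is monotone. [cite: KaibelPashkovich2011, §4.1 (arXiv p. 9)] -/
theorem orbitSet_mono {V V' : Set (Fin 2 → ℝ)} (h : V ⊆ V') : orbitSet N V ⊆ orbitSet N V' :=
  Set.union_subset_union (Set.iUnion_mono fun _ => Set.image_mono h)
    (Set.iUnion_mono fun _ => Set.image_mono h)

/-- `Π_{I₂(N)}(conv V) = conv(orbit V)` ("`Q = conv(W)` with `W = {γ.v}`"). [cite: KaibelPashkovich2011, Prop. 4, proof (arXiv p. 9)] -/
theorem dihedralHull_convexHull (V : Set (Fin 2 → ℝ)) :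
    dihedralHull N (convexHull ℝ V) = convexHull ℝ (orbitSet N V) := by
  apply Set.Subset.antisymm
  · refine convexHull_min ?_ (convex_convexHull ℝ _)
    rintro y hy
    rcases hy with hy | hy
    · obtain ⟨k, hyk⟩ := Set.mem_iUnion.1 hy
      have himg : axisRefl N k '' convexHull ℝ V = convexHull ℝ (axisRefl N k '' V) :=
        (reflectLin (lineNormal (k * π / N))).image_convexHull V
      rw [himg] at hyk
      exact convexHull_mono (fun z hz => Or.inl (Set.mem_iUnion.2 ⟨k, hz⟩)) hyk
    · obtain ⟨k, hyk⟩ := Set.mem_iUnion.1 hy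
      have himg : turn N k '' convexHull ℝ V = convexHull ℝ (turn N k '' V) :=
        (rotLin (2 * k * π / N)).image_convexHull V
      rw [himg] at hyk
      exact convexHull_mono (fun z hz => Or.inr (Set.mem_iUnion.2 ⟨k, hz⟩)) hyk
  · exact convexHull_mono (orbitSet_mono (subset_convexHull ℝ V))

/-- `Π_{I₂(N)}(P)` is closed under the reflections of `I₂(N)` ("`ϱ_{H_i}(Q) ⊆ Q`").
[cite: KaibelPashkovich2011, Prop. 4, proof (arXiv p. 9)] -/
theorem axisRefl_mem_dihedralHull (c : ℤ) {P : Set (Fin 2 → ℝ)} {x : Fin 2 → ℝ} (hx : x ∈ dihedralHull N P) :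
    axisRefl N c x ∈ dihedralHull N P := by
  have himg : axisRefl N c '' dihedralHull N P = convexHull ℝ (axisRefl N c '' orbitSet N P) :=
    (reflectLin (lineNormal (c * π / N))).image_convexHull _
  have hsub : axisRefl N c '' orbitSet N P ⊆ orbitSet N P := by
    rintro _ ⟨y, hy, rfl⟩
    exact axisRefl_mem_orbitSet c hy
  have : axisRefl N c x ∈ axisRefl N c '' dihedralHull N P := ⟨x, hx, rfl⟩
  rw [himg] at this
  exact convexHull_mono hsub this

/-! ### Proposition 4 and Theorem 3 for a general polytope -/

/-- Members of the mirror sequence. [cite: KaibelPashkovich2011, Prop. 4 (arXiv p. 9)] -/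
theorem mem_mirrors {n : ℕ} {h : (Fin 2 → ℝ) × ℝ} (hh : h ∈ mirrors N n) :
    ∃ s < n, h = (lineNormal (lineAngle N s), 0) := by
  simp only [mirrors, List.mem_map, List.mem_range] at hh
  obtain ⟨s, hs, rfl⟩ := hh
  exact ⟨s, hs, rfl⟩

/-- **KP11 Proposition 4 (general polytope, `N ≥ 2`)**: if `P = conv V` contains the canonical image
`ϱ* ∘ ⋯ ∘ ϱ*(w)` of every point `w` of the orbit of `V` (Kaibel–Pashkovich: "`v_Φ ∈ P` for each vertex
`v` of `P`", `v_Φ` the orbit representative in the fundamental domain; `canonSeq_mirrors_mem_wedge`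
shows that the canonical image lies in the fundamental wedge), then the `⌈log₂ N⌉ + 1` mirror relations
map `P` onto `Π_{I₂(N)}(P)`. [cite: KaibelPashkovich2011, Prop. 4 (arXiv p. 9)] -/
theorem KaibelPashkovich2011_prop4_orbit (hN : 2 ≤ N) {P V : Set (Fin 2 → ℝ)} (hPV : P = convexHull ℝ V)
    (hΦ : ∀ w ∈ orbitSet N V, canonSeq (mirrors N (Nat.clog 2 N + 1)) w ∈ P) :
    seqImage (mirrors N (Nat.clog 2 N + 1)) P = dihedralHull N P := by
  have _ := hN
  apply KaibelPashkovich2011_thm1 (W := orbitSet N V)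
  · rw [hPV, dihedralHull_convexHull]
  · rw [hPV]; exact convex_convexHull ℝ V
  · exact (subset_orbitSet P).trans (subset_convexHull ℝ _)
  · intro h hh
    obtain ⟨s, -, rfl⟩ := mem_mirrors hh
    exact lineNormal_ne_zero _
  · intro h hh x hx
    obtain ⟨s, -, rfl⟩ := mem_mirrors hh
    dsimp only
    rw [reflectAt_lineAngle]
    exact axisRefl_mem_dihedralHull _ hx
  · exact hΦ

/-- **KP11 Theorem 3 (general polytope, orbit form)**: under the hypothesis of Proposition 4 an EF of `P`
with `r` inequalities yields one of `Π_{I₂(N)}(P)` with `r + 2⌈log₂ N⌉ + 2` inequalities.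
[cite: KaibelPashkovich2011, Thm. 3 (arXiv p. 9)] -/
theorem KaibelPashkovich2011_thm3_orbit (hN : 2 ≤ N) {P V : Set (Fin 2 → ℝ)} (hPV : P = convexHull ℝ V)
    (hΦ : ∀ w ∈ orbitSet N V, canonSeq (mirrors N (Nat.clog 2 N + 1)) w ∈ P) {r : ℕ}
    (h : HasEFOfSize P r) : HasEFOfSize (dihedralHull N P) (r + 2 * Nat.clog 2 N + 2) := by
  have := h.seqImage (mirrors N (Nat.clog 2 N + 1))
  rw [KaibelPashkovich2011_prop4_orbit hN hPV hΦ, length_mirrors] at this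
  convert this using 1
  ring

/-! ### Orbit representatives in the fundamental wedge are unique -/

/-- Unit vector at angle `θ`. [cite: KaibelPashkovich2011, §4.1.1 (arXiv p. 9)] -/
def unitVec (θ : ℝ) : Fin 2 → ℝ := ![Real.cos θ, Real.sin θ]

/-- `side_φ(ρ u_θ) = ρ sin(θ − φ)`. [cite: KaibelPashkovich2011, §4.1.1 (arXiv p. 9)] -/
theorem side_smul_unitVec (φ ρ θ : ℝ) : side φ (ρ • unitVec θ) = ρ * Real.sin (θ - φ) := by
  rw [side, dotProduct_smul, unitVec, lineNormal_dotProduct_circle, smul_eq_mul]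

/-- Rotations add angles. [cite: KaibelPashkovich2011, §4.1.1 (arXiv p. 9)] -/
theorem turn_smul_unitVec (k : ℤ) (ρ θ : ℝ) :
    turn N k (ρ • unitVec θ) = ρ • unitVec (θ + 2 * k * π / N) := by
  rw [turn, ← rotLin_apply, map_smul, rotLin_apply]
  congr 1
  ext i
  fin_cases i
  · simp [rot, unitVec, Real.cos_add]; ring
  · simp [rot, unitVec, Real.sin_add]; ring

/-- Reflections reflect angles: `ϱ_{H_{cπ/N}}(ρ u_θ) = ρ u_{2cπ/N − θ}`. [cite: KaibelPashkovich2011, §4.1.1 (arXiv p. 9)] -/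
theorem axisRefl_smul_unitVec (c : ℤ) (ρ θ : ℝ) :
    axisRefl N c (ρ • unitVec θ) = ρ • unitVec (2 * (c * π / N) - θ) := by
  rw [axisRefl, ← reflectLin_apply, map_smul, reflectLin_apply, unitVec, reflectAt_lineNormal_circle]
  rfl

/-- `u_{θ + 2πj} = u_θ`. [cite: KaibelPashkovich2011, §4.1.1 (arXiv p. 9)] -/
theorem unitVec_add_int_mul (θ : ℝ) (j : ℤ) : unitVec (θ + j * (2 * π)) = unitVec θ := by
  ext i
  fin_cases i
  · simp [unitVec, Real.cos_add_int_mul_two_pi]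
  · simp [unitVec, Real.sin_add_int_mul_two_pi]

/-- Polar coordinates: every point is `ρ u_θ` with `ρ ≥ 0`, `θ ∈ (−π, π]`.
[cite: KaibelPashkovich2011, §4.1.1 (arXiv p. 9)] -/
theorem exists_polar (y : Fin 2 → ℝ) : ∃ ρ θ : ℝ, 0 ≤ ρ ∧ -π < θ ∧ θ ≤ π ∧ y = ρ • unitVec θ := by
  let ζ : ℂ := ⟨y 0, y 1⟩
  refine ⟨‖ζ‖, Complex.arg ζ, norm_nonneg _, (Complex.arg_mem_Ioc ζ).1, (Complex.arg_mem_Ioc ζ).2, ?_⟩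
  ext i
  fin_cases i
  · simp [unitVec, Complex.norm_mul_cos_arg, ζ]
  · simp [unitVec, Complex.norm_mul_sin_arg, ζ]

/-- `lineAngle N 0 = 2π/N`. [cite: KaibelPashkovich2011, Prop. 4 (arXiv p. 9)] -/
theorem lineAngle_zero (N : ℕ) : lineAngle N 0 = 2 * π / N := by
  rw [lineAngle, pow_zero]
  norm_num

/-- **Angle normalisation**: if `sin(t − π/N) ≥ 0` and `sin(t − 2π/N) ≤ 0` (`N ≥ 2`), then
`t ∈ [π/N, 2π/N]` modulo `2π`. [cite: KaibelPashkovich2011, §4.1.1 (arXiv p. 9: the fundamental domain `Φ_{I₂(m)}`)] -/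
theorem exists_angle_mem_Icc (hN : 2 ≤ N) {t : ℝ} (h1 : 0 ≤ Real.sin (t - π / N))
    (h2 : Real.sin (t - 2 * π / N) ≤ 0) :
    ∃ j : ℤ, π / N ≤ t - j * (2 * π) ∧ t - j * (2 * π) ≤ 2 * π / N := by
  have hNr : (2 : ℝ) ≤ N := by exact_mod_cast hN
  have hNpos : (0 : ℝ) < N := by linarith
  have hπN : 0 < π / N := by positivity
  have h2πN : 2 * π / N = 2 * (π / N) := by ring
  have h2le : 2 * π / N ≤ π := by
    rw [div_le_iff₀ hNpos]; nlinarith [Real.pi_pos, hNr]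
  -- normalise `t` into `(−π, π]`
  set j := toIocDiv Real.two_pi_pos (-π) t with hj
  set t₀ := toIocMod Real.two_pi_pos (-π) t with ht₀
  have hmem := toIocMod_mem_Ioc Real.two_pi_pos (-π) t
  rw [← ht₀] at hmem
  have ht₀eq : t₀ = t - j * (2 * π) := by
    rw [ht₀, hj, ← self_sub_toIocDiv_zsmul, zsmul_eq_mul]
  have hlo : -π < t₀ := hmem.1
  have hhi : t₀ ≤ π := by have := hmem.2; linarith
  refine ⟨j, ?_, ?_⟩ <;> rw [← ht₀eq]
  · -- `t₀ ≥ π/N`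
    have h1' : 0 ≤ Real.sin (t₀ - π / N) := by
      rw [ht₀eq, show t - j * (2 * π) - π / N = (t - π / N) - j * (2 * π) by ring,
        Real.sin_sub_int_mul_two_pi]; exact h1
    have h2' : Real.sin (t₀ - 2 * π / N) ≤ 0 := by
      rw [ht₀eq, show t - j * (2 * π) - 2 * π / N = (t - 2 * π / N) - j * (2 * π) by ring,
        Real.sin_sub_int_mul_two_pi]; exact h2
    by_contra hlt
    push Not at hlt
    by_cases hc : -π < t₀ - π / N
    · have := Real.sin_neg_of_neg_of_neg_pi_lt (by linarith) hc
      linarith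
    · push Not at hc
      -- then `t₀ − 2π/N + 2π ∈ (0, π)`, so `sin(t₀ − 2π/N) > 0`
      have hpos : 0 < Real.sin (t₀ - 2 * π / N + (1 : ℤ) * (2 * π)) := by
        apply Real.sin_pos_of_pos_of_lt_pi
        · push_cast; linarith
        · push_cast; linarith
      rw [Real.sin_add_int_mul_two_pi] at hpos
      linarith
  · -- `t₀ ≤ 2π/N`
    have h2' : Real.sin (t₀ - 2 * π / N) ≤ 0 := by
      rw [ht₀eq, show t - j * (2 * π) - 2 * π / N = (t - 2 * π / N) - j * (2 * π) by ring,
        Real.sin_sub_int_mul_two_pi]; exact h2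
    by_contra hlt
    push Not at hlt
    have := Real.sin_pos_of_pos_of_lt_pi (x := t₀ - 2 * π / N) (by linarith) (by linarith)
    linarith

/-- The orbit relation of `I₂(N)`: `z = γ.y` for a reflection or a rotation `γ`.
[cite: KaibelPashkovich2011, §4.1 (arXiv p. 9)] -/
def InOrbit (N : ℕ) (y z : Fin 2 → ℝ) : Prop := (∃ c : ℤ, z = axisRefl N c y) ∨ ∃ k : ℤ, z = turn N k y

/-- From `ρ sin ≥ 0`, `ρ sin' ≤ 0` (`ρ > 0`) to the bare sines. [folklore] -/
private theorem sin_signs_of_smul {ρ a b : ℝ} (hρ : 0 < ρ) (h1 : 0 ≤ ρ * a) (h2 : ρ * b ≤ 0) :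
    0 ≤ a ∧ b ≤ 0 := by
  constructor
  · by_contra h; push Not at h; nlinarith
  · by_contra h; push Not at h; nlinarith

/-- **Uniqueness of the orbit representative in the fundamental wedge** ("for every point `x ∈ ℝⁿ`,
there is a unique point `x_Φ ∈ Φ_G` that belongs to the orbit of `x`"), for `G = I₂(N)`, `N ≥ 2`.
[cite: KaibelPashkovich2011, §4.1 (arXiv p. 9)] -/
theorem eq_of_inOrbit_of_mem_wedge (hN : 2 ≤ N) {y z : Fin 2 → ℝ} (hy : y ∈ wedge N) (hz : z ∈ wedge N)
    (h : InOrbit N y z) : z = y := by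
  have hNr : (2 : ℝ) ≤ N := by exact_mod_cast hN
  have hNpos : (0 : ℝ) < N := by linarith
  have hN0 : (N : ℝ) ≠ 0 := hNpos.ne'
  set u : ℝ := π / N with hu
  have hupos : 0 < u := by positivity
  have e2u : 2 * π / N = 2 * u := by rw [hu]; ring
  obtain ⟨ρ, θ, hρ, -, -, rfl⟩ := exists_polar y
  rcases hρ.eq_or_lt with hρ0 | hρpos
  · -- `y = 0`
    subst hρ0
    rcases h with ⟨c, rfl⟩ | ⟨k, rfl⟩
    · rw [axisRefl_smul_unitVec, zero_smul, zero_smul]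
    · rw [turn_smul_unitVec, zero_smul, zero_smul]
  -- the angle of `y` lies in `[u, 2u]` modulo `2π`
  obtain ⟨hy1, hy2⟩ := hy
  rw [side_smul_unitVec] at hy1 hy2
  rw [lineAngle_zero] at hy2
  obtain ⟨hy1, hy2⟩ := sin_signs_of_smul hρpos hy1 hy2
  obtain ⟨j, hj1, hj2⟩ := exists_angle_mem_Icc hN hy1 hy2
  rw [e2u] at hj2
  rcases h with ⟨c, rfl⟩ | ⟨k, rfl⟩
  · -- reflection: the angle of `z` is `2cπ/N − θ`
    rw [axisRefl_smul_unitVec] at hz ⊢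
    obtain ⟨h1, h2⟩ := hz
    rw [side_smul_unitVec] at h1 h2
    rw [lineAngle_zero] at h2
    obtain ⟨h1, h2⟩ := sin_signs_of_smul hρpos h1 h2
    obtain ⟨j', hj1', hj2'⟩ := exists_angle_mem_Icc hN h1 h2
    rw [e2u] at hj2'
    -- the integer `m = c − (j + j')N` satisfies `m · 2u = (sum of the two normalised angles)`
    set m : ℤ := c - (j + j') * N with hm
    have hmid : (m : ℝ) * (2 * u) = (θ - j * (2 * π)) + (2 * (c * π / N) - θ - j' * (2 * π)) := by
      rw [hm, hu]; push_cast; field_simp; ring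
    have hm1 : (1 : ℤ) ≤ m := by
      have : (1 : ℝ) * (2 * u) ≤ (m : ℝ) * (2 * u) := by rw [hmid]; linarith
      exact_mod_cast le_of_mul_le_mul_right this (by positivity)
    have hm2 : m ≤ 2 := by
      have : (m : ℝ) * (2 * u) ≤ (2 : ℝ) * (2 * u) := by rw [hmid]; linarith
      exact_mod_cast le_of_mul_le_mul_right this (by positivity)
    have hm12 : m = 1 ∨ m = 2 := by omega
    rcases hm12 with hm' | hm'
    · -- sum `= 2u`: both angles are `u`
      have hsum : (θ - j * (2 * π)) + (2 * (c * π / N) - θ - j' * (2 * π)) = 2 * u := by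
        rw [← hmid, hm']; simp
      have hθ : θ = u + j * (2 * π) := by linarith
      have hθ' : 2 * (c * π / N) - θ = u + j' * (2 * π) := by linarith
      rw [hθ', hθ, unitVec_add_int_mul, unitVec_add_int_mul]
    · -- sum `= 4u`: both angles are `2u`
      have hsum : (θ - j * (2 * π)) + (2 * (c * π / N) - θ - j' * (2 * π)) = 4 * u := by
        rw [← hmid, hm']; push_cast; ring
      have hθ : θ = 2 * u + j * (2 * π) := by linarith
      have hθ' : 2 * (c * π / N) - θ = 2 * u + j' * (2 * π) := by linarith
      rw [hθ', hθ, unitVec_add_int_mul, unitVec_add_int_mul]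
  · -- rotation: the angle of `z` is `θ + 2kπ/N`
    rw [turn_smul_unitVec] at hz ⊢
    obtain ⟨h1, h2⟩ := hz
    rw [side_smul_unitVec] at h1 h2
    rw [lineAngle_zero] at h2
    obtain ⟨h1, h2⟩ := sin_signs_of_smul hρpos h1 h2
    obtain ⟨j', hj1', hj2'⟩ := exists_angle_mem_Icc hN h1 h2
    rw [e2u] at hj2'
    set m : ℤ := k - (j' - j) * N with hm
    have hmid : (m : ℝ) * (2 * u) = (θ + 2 * k * π / N - j' * (2 * π)) - (θ - j * (2 * π)) := by
      rw [hm, hu]; push_cast; field_simp; ring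
    have hm1 : (-1 : ℤ) ≤ 2 * m := by
      have : (-1 : ℝ) * u ≤ ((2 * m : ℤ) : ℝ) * u := by
        rw [show ((2 * m : ℤ) : ℝ) * u = (m : ℝ) * (2 * u) by push_cast; ring, hmid]; linarith
      exact_mod_cast le_of_mul_le_mul_right this hupos
    have hm2 : 2 * m ≤ (1 : ℤ) := by
      have : ((2 * m : ℤ) : ℝ) * u ≤ (1 : ℝ) * u := by
        rw [show ((2 * m : ℤ) : ℝ) * u = (m : ℝ) * (2 * u) by push_cast; ring, hmid]; linarith
      exact_mod_cast le_of_mul_le_mul_right this hupos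
    have hm0 : m = 0 := by omega
    have hdiff : (θ + 2 * k * π / N - j' * (2 * π)) - (θ - j * (2 * π)) = 0 := by
      rw [← hmid, hm0]; simp
    have : θ + 2 * k * π / N = θ + (j' - j : ℤ) * (2 * π) := by
      push_cast; linarith
    rw [this, unitVec_add_int_mul]

/-! ### `I₂(N)` is a group: the orbit relation is an equivalence, and `ϱ* ∘ ⋯ ∘ ϱ*` stays in the orbit -/

/-- Rotations compose by adding angles. [cite: KaibelPashkovich2011, §4.1.1 (arXiv p. 9)] -/
theorem rot_rot (a b : ℝ) (x : Fin 2 → ℝ) : rot a (rot b x) = rot (a + b) x := by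
  ext i
  fin_cases i
  · simp [rot, Real.cos_add, Real.sin_add]; ring
  · simp [rot, Real.cos_add, Real.sin_add]; ring

/-- A rotation after a reflection is a reflection: `rot_θ ∘ ϱ_{H_α} = ϱ_{H_{α + θ/2}}`.
[cite: KaibelPashkovich2011, §4.1.1 (arXiv p. 9)] -/
theorem rot_reflect (θ α : ℝ) (x : Fin 2 → ℝ) :
    rot θ (reflectAt (lineNormal α) 0 x) = reflectAt (lineNormal (α + θ / 2)) 0 x := by
  rw [reflectAt_lineNormal_apply, reflectAt_lineNormal_apply, rot,
    show 2 * (α + θ / 2) = 2 * α + θ by ring]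
  ext i
  fin_cases i
  · simp [Real.cos_add, Real.sin_add]; ring
  · simp [Real.cos_add, Real.sin_add]; ring

/-- `rot_{2kπ/N} ∘ rot_{2jπ/N} = rot_{2(k+j)π/N}`. [cite: KaibelPashkovich2011, §4.1.1 (arXiv p. 9)] -/
theorem turn_turn (k j : ℤ) (x : Fin 2 → ℝ) : turn N k (turn N j x) = turn N (k + j) x := by
  rw [turn, turn, turn, rot_rot]
  congr 1
  push_cast
  ring

/-- `rot_{2kπ/N} ∘ ϱ_{H_{aπ/N}} = ϱ_{H_{(k+a)π/N}}`. [cite: KaibelPashkovich2011, §4.1.1 (arXiv p. 9)] -/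
theorem turn_axisRefl (k a : ℤ) (x : Fin 2 → ℝ) : turn N k (axisRefl N a x) = axisRefl N (k + a) x := by
  rw [turn, axisRefl, axisRefl, rot_reflect]
  congr 3
  push_cast
  ring

/-- The orbit relation is reflexive. [cite: KaibelPashkovich2011, §4.1 (arXiv p. 9)] -/
theorem InOrbit.rfl {y : Fin 2 → ℝ} : InOrbit N y y := Or.inr ⟨0, (turn_zero y).symm⟩

/-- The orbit relation is symmetric (reflections are involutions, rotations invert).
[cite: KaibelPashkovich2011, §4.1 (arXiv p. 9)] -/
theorem InOrbit.symm {y z : Fin 2 → ℝ} (h : InOrbit N y z) : InOrbit N z y := by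
  rcases h with ⟨c, rfl⟩ | ⟨k, rfl⟩
  · exact Or.inl ⟨c, by rw [axisRefl_axisRefl, sub_self, turn_zero]⟩
  · exact Or.inr ⟨-k, by rw [turn_turn, neg_add_cancel, turn_zero]⟩

/-- The orbit relation is transitive (`I₂(N)` is closed under composition).
[cite: KaibelPashkovich2011, §4.1 (arXiv p. 9)] -/
theorem InOrbit.trans {x y z : Fin 2 → ℝ} (h₁ : InOrbit N x y) (h₂ : InOrbit N y z) : InOrbit N x z := by
  rcases h₁ with ⟨c, rfl⟩ | ⟨k, rfl⟩ <;> rcases h₂ with ⟨c', rfl⟩ | ⟨k', rfl⟩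
  · exact Or.inr ⟨c' - c, axisRefl_axisRefl c' c x⟩
  · exact Or.inl ⟨k' + c, turn_axisRefl k' c x⟩
  · exact Or.inl ⟨c' - k, axisRefl_turn c' k x⟩
  · exact Or.inr ⟨k' + k, turn_turn k' k x⟩

/-- **`ϱ*_{H₁} ∘ ⋯ ∘ ϱ*_{H_n}(x)` lies in the `I₂(N)`-orbit of `x`** (each canonical map is the identity or
a reflection of the group). [cite: KaibelPashkovich2011, Prop. 4, proof (arXiv p. 9: "it equals `w_Φ`")] -/
theorem inOrbit_canonSeq_mirrors : ∀ (n : ℕ) (x : Fin 2 → ℝ), InOrbit N x (canonSeq (mirrors N n) x)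
  | 0, x => by
      have : mirrors N 0 = [] := by simp [mirrors]
      rw [this, canonSeq]
      exact InOrbit.rfl
  | n + 1, x => by
      rw [mirrors_succ, canonSeq_append_singleton]
      refine InOrbit.trans ?_ (inOrbit_canonSeq_mirrors n _)
      dsimp only
      by_cases h : side (lineAngle N n) x ≤ 0
      · rw [canon_lineNormal_of_le h]
        exact InOrbit.rfl
      · rw [canon_lineNormal_of_gt (not_le.1 h), reflectAt_lineAngle]
        exact Or.inl ⟨_, rfl⟩

/-- Points of the orbit set are in the orbit of a point of `V`. [cite: KaibelPashkovich2011, §4.1 (arXiv p. 9)] -/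
theorem exists_inOrbit_of_mem_orbitSet {V : Set (Fin 2 → ℝ)} {w : Fin 2 → ℝ} (hw : w ∈ orbitSet N V) :
    ∃ v ∈ V, InOrbit N v w := by
  rcases hw with hw | hw
  · obtain ⟨c, ⟨v, hv, rfl⟩⟩ := Set.mem_iUnion.1 hw
    exact ⟨v, hv, Or.inl ⟨c, rfl⟩⟩
  · obtain ⟨k, ⟨v, hv, rfl⟩⟩ := Set.mem_iUnion.1 hw
    exact ⟨v, hv, Or.inr ⟨k, rfl⟩⟩

/-- **The canonical image is an orbit invariant**: `ϱ* ∘ ⋯ ∘ ϱ*(γ.v) = ϱ* ∘ ⋯ ∘ ϱ*(v)` — both are the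
unique representative `v_Φ` of the orbit in the fundamental wedge ("we conclude that it equals
`w_Φ = v_Φ`"). [cite: KaibelPashkovich2011, Prop. 4, proof (arXiv p. 9)] -/
theorem canonSeq_mirrors_eq_of_inOrbit (hN : 2 ≤ N) {v w : Fin 2 → ℝ} (h : InOrbit N v w) :
    canonSeq (mirrors N (Nat.clog 2 N + 1)) w = canonSeq (mirrors N (Nat.clog 2 N + 1)) v :=
  eq_of_inOrbit_of_mem_wedge hN (canonSeq_mirrors_mem_wedge hN v) (canonSeq_mirrors_mem_wedge hN w)
    (((inOrbit_canonSeq_mirrors _ v).symm.trans h).trans (inOrbit_canonSeq_mirrors _ w))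

/-- **KP11 Proposition 4 for a general polytope** (`N ≥ 2`, tree normalisation of the `N`-gon): if
`P = conv V ⊆ ℝ²` contains `v_Φ = ϱ* ∘ ⋯ ∘ ϱ*(v)` — the representative of `v` in the fundamental wedge —
for every `v ∈ V`, then the `⌈log₂ N⌉ + 1` mirror relations map `P` onto `Π_{I₂(N)}(P)`.
[cite: KaibelPashkovich2011, Prop. 4 (arXiv p. 9)] -/
theorem KaibelPashkovich2011_prop4 (hN : 2 ≤ N) {P V : Set (Fin 2 → ℝ)} (hPV : P = convexHull ℝ V)
    (hΦ : ∀ v ∈ V, canonSeq (mirrors N (Nat.clog 2 N + 1)) v ∈ P) :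
    seqImage (mirrors N (Nat.clog 2 N + 1)) P = dihedralHull N P := by
  refine KaibelPashkovich2011_prop4_orbit hN hPV fun w hw => ?_
  obtain ⟨v, hv, hvw⟩ := exists_inOrbit_of_mem_orbitSet hw
  rw [canonSeq_mirrors_eq_of_inOrbit hN hvw]
  exact hΦ v hv

/-- **KP11 Theorem 3 for a general polytope**: "For each polytope `P ⊆ ℝ²` with `v_Φ ∈ P` for each
vertex `v` of `P` that admits an extended formulation with `n'` variables and `f'` inequalities, there
is an extended formulation of `Π_{I₂(m)}(P)` with `n' + ⌈log(m)⌉ + 1` variables and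
`f' + 2⌈log(m)⌉ + 2` inequalities" — here with a generating set `V` in place of the vertices and the
tree's inequality count. [cite: KaibelPashkovich2011, Thm. 3 (arXiv p. 9)] -/
theorem KaibelPashkovich2011_thm3 (hN : 2 ≤ N) {P V : Set (Fin 2 → ℝ)} (hPV : P = convexHull ℝ V)
    (hΦ : ∀ v ∈ V, canonSeq (mirrors N (Nat.clog 2 N + 1)) v ∈ P) {r : ℕ} (h : HasEFOfSize P r) :
    HasEFOfSize (dihedralHull N P) (r + 2 * Nat.clog 2 N + 2) := by
  have := h.seqImage (mirrors N (Nat.clog 2 N + 1))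
  rw [KaibelPashkovich2011_prop4 hN hPV hΦ, length_mirrors] at this
  convert this using 1
  ring

end RegularPolygon

end Literature.Combinatorics.Optimization

end
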